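import Mathlib
import Summits.AtomisticToContinuum.HydrodynamicLimit.Theorems.ImplosionDichotomyDenseExcursionPackingAnalyticDefs

/-!
# The order-one equation of the hierarchy of the analytic packing implosion `Γ`
# (crux `DenseExcursion`, stmt-AtomisticToContinuum-12586, line `packing-analytic-implosion`)

Helper file (`--supports stmt-AtomisticToContinuum-12586`, line lead a2, stub `stub_analyticPackingImplosion` of
`…ImplosionDichotomyDenseExcursionPackingAnalyticDefs.lean`). THE FORMAL HIERARCHY AT ORDER ONE, kernel-checked:
if `(w, s)(G, x)` is jointly `C^∞` on `(−g₀, g₀) × ℝ`, equals `(W, S)` at `G = 0` and solves the two equations of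
`AnalyticPackingImplosion r W S M` (`∂_τ = μ G ∂_G`, `μ = 3(r − 1)`, stiffening law `M` differentiable at `0` with
`M 0 = 1`), then its first `G`-Taylor coefficient `X₁ = (w₁, s₁) := (∂_G w, ∂_G s)|_{G=0}` solves the LINEAR
order-one problem
`μ w₁ − linW(w₁, s₁) = 3 S (S′ + S) · M′(0) · e^{3x} S³`, `μ s₁ − linS(w₁, s₁) = 0`
for the tree's linearised operator `L = (linW, linS)` (`…R2Modes.lean`), stated through the complex vocabulary by
coercion exactly as `LargeRealResolvent` is (`packingHierarchy_order_one`, REGISTERED helper). This pins the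
conventions (signs, the factor `e^{3x} S³ = ∂_G(G e^{3x} s³)|₀`, the placement of `M′(0)`; for the hard-sphere law
`M = stiffening F`, `M′(0) = (8/3)F′(0) = 16π/9` at `F′(0) = 2π/3`) for everyone computing `X₁`, the object the first
Melnikov functional of the shadowing chart pairs against. Also, kernel-checked:
* `order_one_of_analyticPackingImplosion` — the same read off an `AnalyticPackingImplosion r W S M` witness, WITH
  centre regularity: `(w₁, s₁)` is a smooth `IsRegularPair` (its radial fields are the `G`-derivatives at `0` of the
  witness's jointly smooth fields `Fv, Gc`; `contDiff_coeff_one`);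
* `hierarchy_solution_unique` — at EVERY order `k ≥ 1` the problem `(kμ − L)X = Src` has at most one smooth
  centre-regular solution under the `(1,2)` package and `kμ ≠ r` (difference = smooth radial mode at `kμ`, excluded
  by the landed `packing_nonresonance`); so `X₁` above is THE regular solution of the order-one problem.

Mathematics: differentiate the two equations in `G` at `G = 0` (product and chain rules) and exchange `∂_G ∂_x =
∂_x ∂_G` (Schwarz, `ContDiffAt.isSymmSndFDerivAt`); the slice lemmas `hasDerivAt_slice_fst/snd`,
`hasDerivAt_fderiv_slice_fst/snd` translate between the curried `deriv`s of the definition and `fderiv` of the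
uncurried field. NOT here: existence of `Γ` (the stub), the sources at orders `k ≥ 2`, norms.
-/

noncomputable section

open Filter Set
open scoped Topology ContDiff

namespace Summit.AtomisticToContinuum.HydrodynamicLimit.Theorems.PackingAnalyticImplosion

open Summit.AtomisticToContinuum.HydrodynamicLimit.Theorems.R2OneModeTwoConditions

section Slices

variable {E F : Type*} [NormedAddCommGroup E] [NormedSpace ℝ E] [NormedAddCommGroup F] [NormedSpace ℝ F]

/-- Partial derivative in the FIRST (parameter) variable of `f : ℝ × E → F` along the slice `t ↦ (t, b)`:
it is `Df (a, b) (1, 0)`. [folklore] -/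
theorem hasDerivAt_slice_fst {f : ℝ × E → F} {a : ℝ} {b : E} (hf : DifferentiableAt ℝ f (a, b)) :
    HasDerivAt (fun t => f (t, b)) (fderiv ℝ f (a, b) (1, 0)) a := by
  have h1 : HasDerivAt (fun t : ℝ => (t, b)) ((1 : ℝ), (0 : E)) a :=
    (hasDerivAt_id' a).prodMk (hasDerivAt_const a b)
  exact hf.hasFDerivAt.comp_hasDerivAt a h1

/-- Partial derivative in the SECOND variable of `f : ℝ × ℝ → F` along the slice `t ↦ (a, t)`:
it is `Df (a, b) (0, 1)`. [folklore] -/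
theorem hasDerivAt_slice_snd {f : ℝ × ℝ → F} {a b : ℝ} (hf : DifferentiableAt ℝ f (a, b)) :
    HasDerivAt (fun t => f (a, t)) (fderiv ℝ f (a, b) (0, 1)) b := by
  have h1 : HasDerivAt (fun t : ℝ => (a, t)) ((0 : ℝ), (1 : ℝ)) b :=
    (hasDerivAt_const b a).prodMk (hasDerivAt_id' b)
  exact hf.hasFDerivAt.comp_hasDerivAt b h1

/-- Derivative along the slice `t ↦ (t, b)` of a directional derivative `Df (·) v` of a `C²` function
`f : ℝ × E → F`: it is `D²f (a, b) (1, 0) v`. [folklore] -/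
theorem hasDerivAt_fderiv_slice_fst {f : ℝ × E → F} {a : ℝ} {b : E} (hf : ContDiffAt ℝ 2 f (a, b))
    (v : ℝ × E) :
    HasDerivAt (fun t => fderiv ℝ f (t, b) v) (fderiv ℝ (fderiv ℝ f) (a, b) (1, 0) v) a := by
  have hd : DifferentiableAt ℝ (fderiv ℝ f) (a, b) :=
    (hf.fderiv_right (m := 1) (by norm_num)).differentiableAt one_ne_zero
  have h2 := hasDerivAt_slice_fst hd
  simpa using h2.clm_apply (hasDerivAt_const a v)

/-- Derivative along the slice `t ↦ (a, t)` of a directional derivative `Df (·) v` of a `C²` function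
`f : ℝ × ℝ → F`: it is `D²f (a, b) (0, 1) v`. [folklore] -/
theorem hasDerivAt_fderiv_slice_snd {f : ℝ × ℝ → F} {a b : ℝ} (hf : ContDiffAt ℝ 2 f (a, b))
    (v : ℝ × ℝ) :
    HasDerivAt (fun t => fderiv ℝ f (a, t) v) (fderiv ℝ (fderiv ℝ f) (a, b) (0, 1) v) b := by
  have hd : DifferentiableAt ℝ (fderiv ℝ f) (a, b) :=
    (hf.fderiv_right (m := 1) (by norm_num)).differentiableAt one_ne_zero
  have h2 := hasDerivAt_slice_snd hd
  simpa using h2.clm_apply (hasDerivAt_const b v)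

/-- Symmetry of the second derivative of a `C²` function (Schwarz), in the form used below. [folklore] -/
theorem fderiv_fderiv_swap {f : ℝ × E → F} {p : ℝ × E} (hf : ContDiffAt ℝ 2 f p) (u v : ℝ × E) :
    fderiv ℝ (fderiv ℝ f) p u v = fderiv ℝ (fderiv ℝ f) p v u :=
  hf.isSymmSndFDerivAt (by simp) u v

end Slices

/-- **THE ORDER-ONE EQUATION OF `Γ`'S HIERARCHY** (registered helper `packingHierarchy_order_one` of
`stub_analyticPackingImplosion`). For a jointly smooth family `(w, s)(G, x)` on `(−g₀, g₀) × ℝ` through `(W, S)` at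
`G = 0` solving the two equations of `AnalyticPackingImplosion r W S M` (with `M` differentiable at `0`, `M 0 = 1`),
the first `G`-coefficient `(w₁, s₁) = (∂_G w, ∂_G s)|_{G = 0}` solves
`μ w₁ − linW r W S w₁ s₁ = 3 S (S′ + S) · M′(0) · e^{3x} S³` and `μ s₁ − linS r W S w₁ s₁ = 0`, `μ = 3(r − 1)`
(real pairs coerced to `ℂ` as in `LargeRealResolvent`). [folklore] -/
theorem packingHierarchy_order_one :
    ∀ (r : ℝ) (W S M : ℝ → ℝ) (g₀ : ℝ) (w s : ℝ → ℝ → ℝ), 0 < g₀ →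
      ContDiffOn ℝ ∞ (fun p : ℝ × ℝ => w p.1 p.2) (Set.Ioo (-g₀) g₀ ×ˢ Set.univ) →
      ContDiffOn ℝ ∞ (fun p : ℝ × ℝ => s p.1 p.2) (Set.Ioo (-g₀) g₀ ×ˢ Set.univ) →
      (∀ x, w 0 x = W x ∧ s 0 x = S x) → DifferentiableAt ℝ M 0 → M 0 = 1 →
      (∀ G ∈ Set.Ioo (-g₀) g₀, ∀ x,
        3 * (r - 1) * G * deriv (fun G' => s G' x) G =
            (w G x - 1) * deriv (fun x' => s G x') x + s G x / 3 * deriv (fun x' => w G x') x +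
              s G x * (2 * w G x - r) ∧
        3 * (r - 1) * G * deriv (fun G' => w G' x) G =
            (w G x - 1) * deriv (fun x' => w G x') x + w G x ^ 2 - r * w G x +
              3 * s G x * (deriv (fun x' => s G x') x + s G x) * M (G * Real.exp (3 * x) * s G x ^ 3)) →
      ∀ x, ((3 * (r - 1) : ℝ) : ℂ) * ((deriv (fun G => w G x) 0 : ℝ) : ℂ) -
            linW r W S (fun y => ((deriv (fun G => w G y) 0 : ℝ) : ℂ))
              (fun y => ((deriv (fun G => s G y) 0 : ℝ) : ℂ)) x =
          ((3 * S x * (deriv S x + S x) * (deriv M 0 * (Real.exp (3 * x) * S x ^ 3)) : ℝ) : ℂ) ∧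
        ((3 * (r - 1) : ℝ) : ℂ) * ((deriv (fun G => s G x) 0 : ℝ) : ℂ) -
            linS r W S (fun y => ((deriv (fun G => w G y) 0 : ℝ) : ℂ))
              (fun y => ((deriv (fun G => s G y) 0 : ℝ) : ℂ)) x = 0 := by
  intro r W S M g₀ w s hg₀ hw hs h0 hM hM0 heq x
  -- the open domain and `C²`-regularity of the uncurried fields at its points
  have hU : IsOpen (Set.Ioo (-g₀) g₀ ×ˢ (Set.univ : Set ℝ)) := isOpen_Ioo.prod isOpen_univ
  have h0I : (0 : ℝ) ∈ Set.Ioo (-g₀) g₀ := ⟨by linarith, hg₀⟩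
  have hIn : Set.Ioo (-g₀) g₀ ∈ 𝓝 (0 : ℝ) := isOpen_Ioo.mem_nhds h0I
  have hw' : ContDiffOn ℝ ∞ (Function.uncurry w) (Set.Ioo (-g₀) g₀ ×ˢ Set.univ) := hw
  have hs' : ContDiffOn ℝ ∞ (Function.uncurry s) (Set.Ioo (-g₀) g₀ ×ˢ Set.univ) := hs
  have hw2 : ∀ G ∈ Set.Ioo (-g₀) g₀, ∀ y : ℝ, ContDiffAt ℝ 2 (Function.uncurry w) (G, y) :=
    fun G hG y => (hw'.contDiffAt (hU.mem_nhds ⟨hG, Set.mem_univ y⟩)).of_le (ENat.natCast_le_of_coe_top_le_withTop le_rfl 2)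
  have hs2 : ∀ G ∈ Set.Ioo (-g₀) g₀, ∀ y : ℝ, ContDiffAt ℝ 2 (Function.uncurry s) (G, y) :=
    fun G hG y => (hs'.contDiffAt (hU.mem_nhds ⟨hG, Set.mem_univ y⟩)).of_le (ENat.natCast_le_of_coe_top_le_withTop le_rfl 2)
  have hwd : ∀ G ∈ Set.Ioo (-g₀) g₀, ∀ y : ℝ, DifferentiableAt ℝ (Function.uncurry w) (G, y) :=
    fun G hG y => (hw2 G hG y).differentiableAt (by norm_num)
  have hsd : ∀ G ∈ Set.Ioo (-g₀) g₀, ∀ y : ℝ, DifferentiableAt ℝ (Function.uncurry s) (G, y) :=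
    fun G hG y => (hs2 G hG y).differentiableAt (by norm_num)
  -- the curried slice derivatives of the statement as Fréchet derivatives of the uncurried fields
  have eWG : ∀ G ∈ Set.Ioo (-g₀) g₀, ∀ y, deriv (fun G' => w G' y) G =
      fderiv ℝ (Function.uncurry w) (G, y) (1, 0) :=
    fun G hG y => (hasDerivAt_slice_fst (hwd G hG y)).deriv
  have eSG : ∀ G ∈ Set.Ioo (-g₀) g₀, ∀ y, deriv (fun G' => s G' y) G =
      fderiv ℝ (Function.uncurry s) (G, y) (1, 0) :=
    fun G hG y => (hasDerivAt_slice_fst (hsd G hG y)).deriv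
  have eWx : ∀ G ∈ Set.Ioo (-g₀) g₀, ∀ y, deriv (fun x' => w G x') y =
      fderiv ℝ (Function.uncurry w) (G, y) (0, 1) :=
    fun G hG y => (hasDerivAt_slice_snd (hwd G hG y)).deriv
  have eSx : ∀ G ∈ Set.Ioo (-g₀) g₀, ∀ y, deriv (fun x' => s G x') y =
      fderiv ℝ (Function.uncurry s) (G, y) (0, 1) :=
    fun G hG y => (hasDerivAt_slice_snd (hsd G hG y)).deriv
  -- values at `G = 0`
  have hW0 : ∀ y, w 0 y = W y := fun y => (h0 y).1
  have hS0 : ∀ y, s 0 y = S y := fun y => (h0 y).2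
  have hWfun : (fun y => w 0 y) = W := funext hW0
  have hSfun : (fun y => s 0 y) = S := funext hS0
  have eW' : fderiv ℝ (Function.uncurry w) (0, x) (0, 1) = deriv W x := by rw [← eWx 0 h0I x, hWfun]
  have eS' : fderiv ℝ (Function.uncurry s) (0, x) (0, 1) = deriv S x := by rw [← eSx 0 h0I x, hSfun]
  -- `G`-derivatives at `0` of the ingredients (Schwarz for the mixed ones)
  have dW : HasDerivAt (fun G => w G x) (fderiv ℝ (Function.uncurry w) (0, x) (1, 0)) 0 :=
    hasDerivAt_slice_fst (hwd 0 h0I x)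
  have dS : HasDerivAt (fun G => s G x) (fderiv ℝ (Function.uncurry s) (0, x) (1, 0)) 0 :=
    hasDerivAt_slice_fst (hsd 0 h0I x)
  have dWx : HasDerivAt (fun G => fderiv ℝ (Function.uncurry w) (G, x) (0, 1))
      (fderiv ℝ (fderiv ℝ (Function.uncurry w)) (0, x) (0, 1) (1, 0)) 0 := by
    have h := hasDerivAt_fderiv_slice_fst (hw2 0 h0I x) (0, 1)
    rwa [fderiv_fderiv_swap (hw2 0 h0I x) (1, 0) (0, 1)] at h
  have dSx : HasDerivAt (fun G => fderiv ℝ (Function.uncurry s) (G, x) (0, 1))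
      (fderiv ℝ (fderiv ℝ (Function.uncurry s)) (0, x) (0, 1) (1, 0)) 0 := by
    have h := hasDerivAt_fderiv_slice_fst (hs2 0 h0I x) (0, 1)
    rwa [fderiv_fderiv_swap (hs2 0 h0I x) (1, 0) (0, 1)] at h
  have dWG : HasDerivAt (fun G => fderiv ℝ (Function.uncurry w) (G, x) (1, 0))
      (fderiv ℝ (fderiv ℝ (Function.uncurry w)) (0, x) (1, 0) (1, 0)) 0 :=
    hasDerivAt_fderiv_slice_fst (hw2 0 h0I x) (1, 0)
  have dSG : HasDerivAt (fun G => fderiv ℝ (Function.uncurry s) (G, x) (1, 0))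
      (fderiv ℝ (fderiv ℝ (Function.uncurry s)) (0, x) (1, 0) (1, 0)) 0 :=
    hasDerivAt_fderiv_slice_fst (hs2 0 h0I x) (1, 0)
  -- the stiffening factor along the family: `G ↦ M (G e^{3x} s(G,x)³)` at `G = 0`
  have hin : HasDerivAt (fun G => G * Real.exp (3 * x) * s G x ^ 3) (Real.exp (3 * x) * S x ^ 3) 0 := by
    have h := ((hasDerivAt_id' (0 : ℝ)).mul_const (Real.exp (3 * x))).fun_mul (dS.fun_pow 3)
    exact h.congr_deriv (by simp [hS0])
  have hMc : HasDerivAt (fun G => M (G * Real.exp (3 * x) * s G x ^ 3))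
      (deriv M 0 * (Real.exp (3 * x) * S x ^ 3)) 0 := by
    have hM' : HasDerivAt M (deriv M 0) ((fun G => G * Real.exp (3 * x) * s G x ^ 3) 0) := by
      simp only [zero_mul]
      exact hM.hasDerivAt
    exact hM'.comp 0 hin
  -- the `x`-derivatives of the first coefficients `w₁, s₁` at `x`
  have hw₁fun : (fun y => deriv (fun G => w G y) 0) = fun y => fderiv ℝ (Function.uncurry w) (0, y) (1, 0) :=
    funext fun y => eWG 0 h0I y
  have hs₁fun : (fun y => deriv (fun G => s G y) 0) = fun y => fderiv ℝ (Function.uncurry s) (0, y) (1, 0) :=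
    funext fun y => eSG 0 h0I y
  have hw₁ : HasDerivAt (fun y => deriv (fun G => w G y) 0)
      (fderiv ℝ (fderiv ℝ (Function.uncurry w)) (0, x) (0, 1) (1, 0)) x := by
    rw [hw₁fun]
    exact hasDerivAt_fderiv_slice_snd (hw2 0 h0I x) (1, 0)
  have hs₁ : HasDerivAt (fun y => deriv (fun G => s G y) 0)
      (fderiv ℝ (fderiv ℝ (Function.uncurry s)) (0, x) (0, 1) (1, 0)) x := by
    rw [hs₁fun]
    exact hasDerivAt_fderiv_slice_snd (hs2 0 h0I x) (1, 0)
  have hdw₁ := hw₁.ofReal_comp.deriv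
  have hds₁ := hs₁.ofReal_comp.deriv
  -- the two equations as identities of functions of `G` near `0`, in `fderiv` form
  have hev2 : (fun G => 3 * (r - 1) * G * fderiv ℝ (Function.uncurry w) (G, x) (1, 0)) =ᶠ[𝓝 0]
      fun G => (w G x - 1) * fderiv ℝ (Function.uncurry w) (G, x) (0, 1) + w G x ^ 2 - r * w G x +
        3 * s G x * (fderiv ℝ (Function.uncurry s) (G, x) (0, 1) + s G x) *
          M (G * Real.exp (3 * x) * s G x ^ 3) := by
    filter_upwards [hIn] with G hG
    have h := (heq G hG x).2
    rwa [eWG G hG x, eWx G hG x, eSx G hG x] at h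
  have hev1 : (fun G => 3 * (r - 1) * G * fderiv ℝ (Function.uncurry s) (G, x) (1, 0)) =ᶠ[𝓝 0]
      fun G => (w G x - 1) * fderiv ℝ (Function.uncurry s) (G, x) (0, 1) +
        s G x / 3 * fderiv ℝ (Function.uncurry w) (G, x) (0, 1) + s G x * (2 * w G x - r) := by
    filter_upwards [hIn] with G hG
    have h := (heq G hG x).1
    rwa [eSG G hG x, eSx G hG x, eWx G hG x] at h
  -- differentiate both sides at `G = 0`
  have dL2 : HasDerivAt (fun G => 3 * (r - 1) * G * fderiv ℝ (Function.uncurry w) (G, x) (1, 0))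
      (3 * (r - 1) * fderiv ℝ (Function.uncurry w) (0, x) (1, 0)) 0 := by
    have h := ((hasDerivAt_id' (0 : ℝ)).const_mul (3 * (r - 1))).fun_mul dWG
    exact h.congr_deriv (by ring)
  have dL1 : HasDerivAt (fun G => 3 * (r - 1) * G * fderiv ℝ (Function.uncurry s) (G, x) (1, 0))
      (3 * (r - 1) * fderiv ℝ (Function.uncurry s) (0, x) (1, 0)) 0 := by
    have h := ((hasDerivAt_id' (0 : ℝ)).const_mul (3 * (r - 1))).fun_mul dSG
    exact h.congr_deriv (by ring)
  have dR2 := ((((dW.sub_const 1).fun_mul dWx).fun_add (dW.fun_pow 2)).fun_sub (dW.const_mul r)).fun_add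
    (((dS.const_mul 3).fun_mul (dSx.fun_add dS)).fun_mul hMc)
  have dR1 := (((dW.sub_const 1).fun_mul dSx).fun_add ((dS.div_const 3).fun_mul dWx)).fun_add
    (dS.fun_mul ((dW.const_mul 2).sub_const r))
  have key2 := dL2.unique (dR2.congr_of_eventuallyEq hev2)
  have key1 := dL1.unique (dR1.congr_of_eventuallyEq hev1)
  simp only [hW0, hS0, zero_mul, hM0, eW', eS', Nat.cast_ofNat] at key2 key1
  have key2C := congrArg (fun t : ℝ => (t : ℂ)) key2
  have key1C := congrArg (fun t : ℝ => (t : ℂ)) key1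
  refine ⟨?_, ?_⟩
  · simp only [linW, hdw₁, hds₁, eWG 0 h0I x, eSG 0 h0I x]
    push_cast at key2C ⊢
    linear_combination key2C
  · simp only [linS, hdw₁, hds₁, eWG 0 h0I x, eSG 0 h0I x]
    push_cast at key1C ⊢
    linear_combination key1C

/-! ## The first coefficient of a `Γ` witness: smoothness, centre regularity, the order-one problem -/

section CoeffOne

variable {E F : Type*} [NormedAddCommGroup E] [NormedSpace ℝ E] [NormedAddCommGroup F] [NormedSpace ℝ F]

/-- For `Φ : ℝ → E → F` jointly `C^∞` on `(−g₀, g₀) × E`, the first `G`-coefficient `y ↦ ∂_G Φ(0, y)`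
(`= DΦ (0, y) (1, 0)`) is `C^∞` on `E`, and it is the `G`-derivative at `0` of every slice `G ↦ Φ G y`.
[folklore] -/
theorem contDiff_coeff_one {Φ : ℝ → E → F} {g₀ : ℝ} (hg₀ : 0 < g₀)
    (hΦ : ContDiffOn ℝ ∞ (Function.uncurry Φ) (Set.Ioo (-g₀) g₀ ×ˢ Set.univ)) :
    ContDiff ℝ ∞ (fun y => fderiv ℝ (Function.uncurry Φ) (0, y) (1, 0)) ∧
      ∀ y, HasDerivAt (fun G => Φ G y) (fderiv ℝ (Function.uncurry Φ) (0, y) (1, 0)) 0 := by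
  have hU : IsOpen (Set.Ioo (-g₀) g₀ ×ˢ (Set.univ : Set E)) := isOpen_Ioo.prod isOpen_univ
  have h0I : (0 : ℝ) ∈ Set.Ioo (-g₀) g₀ := ⟨by linarith, hg₀⟩
  have hD := (contDiffOn_infty_iff_fderiv_of_isOpen hU).1 hΦ
  refine ⟨?_, fun y => hasDerivAt_slice_fst
    ((hD.1 _ ⟨h0I, Set.mem_univ y⟩).differentiableAt (hU.mem_nhds ⟨h0I, Set.mem_univ y⟩))⟩
  have hcomp : ContDiff ℝ ∞ ((fderiv ℝ (Function.uncurry Φ)) ∘ fun y : E => ((0 : ℝ), y)) :=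
    hD.2.comp_contDiff (contDiff_const.prodMk contDiff_id) fun y => ⟨h0I, Set.mem_univ y⟩
  exact hcomp.clm_apply contDiff_const

end CoeffOne

/-- **The first coefficient `X₁` of an analytic packing implosion solves the order-one problem and is
centre-regular.** From a witness of `AnalyticPackingImplosion r W S M` (`M` differentiable at `0`, `M 0 = 1`):
`(w₁, s₁) := (∂_G w, ∂_G s)|_{G=0}` is a smooth centre-regular real pair (`IsRegularPair`, the radial fields being the
`G`-derivatives at `0` of the witness's fields `Fv, Gc`) solving `μ w₁ − linW = 3 S (S′+S) M′(0) e^{3x} S³`,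
`μ s₁ − linS = 0`. By `hierarchy_solution_unique` it is THE regular solution. [folklore] -/
theorem order_one_of_analyticPackingImplosion {r : ℝ} {W S M : ℝ → ℝ}
    (h : AnalyticPackingImplosion r W S M) (hM : DifferentiableAt ℝ M 0) (hM0 : M 0 = 1) :
    ∃ w₁ s₁ : ℝ → ℝ, IsRegularPair (fun x => (w₁ x : ℂ)) (fun x => (s₁ x : ℂ)) ∧
      ∀ x, ((3 * (r - 1) : ℝ) : ℂ) * (w₁ x : ℂ) -
            linW r W S (fun y => (w₁ y : ℂ)) (fun y => (s₁ y : ℂ)) x =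
          ((3 * S x * (deriv S x + S x) * (deriv M 0 * (Real.exp (3 * x) * S x ^ 3)) : ℝ) : ℂ) ∧
        ((3 * (r - 1) : ℝ) : ℂ) * (s₁ x : ℂ) -
            linS r W S (fun y => (w₁ y : ℂ)) (fun y => (s₁ y : ℂ)) x = 0 := by
  obtain ⟨g₀, hg₀, w, s, hw, hs, -, h0, -, ⟨Fv, Gc, hFv, hGc, -, hreg⟩, heq⟩ := h
  refine ⟨fun y => deriv (fun G => w G y) 0, fun y => deriv (fun G => s G y) 0, ?_,
    packingHierarchy_order_one r W S M g₀ w s hg₀ hw hs h0 hM hM0 heq⟩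
  have hIn : Set.Ioo (-g₀) g₀ ∈ 𝓝 (0 : ℝ) := isOpen_Ioo.mem_nhds ⟨by linarith, hg₀⟩
  obtain ⟨hw₁, dw⟩ := contDiff_coeff_one (Φ := w) hg₀ hw
  obtain ⟨hs₁, ds⟩ := contDiff_coeff_one (Φ := s) hg₀ hs
  obtain ⟨hF₁, dF⟩ := contDiff_coeff_one (Φ := Fv) hg₀ hFv
  obtain ⟨hG₁, dG⟩ := contDiff_coeff_one (Φ := Gc) hg₀ hGc
  have ew : ∀ y, deriv (fun G => w G y) 0 = fderiv ℝ (Function.uncurry w) (0, y) (1, 0) :=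
    fun y => (dw y).deriv
  have es : ∀ y, deriv (fun G => s G y) 0 = fderiv ℝ (Function.uncurry s) (0, y) (1, 0) :=
    fun y => (ds y).deriv
  simp only [ew, es]
  refine ⟨Complex.ofRealCLM.contDiff.comp hw₁, Complex.ofRealCLM.contDiff.comp hs₁,
    fun y => fderiv ℝ (Function.uncurry Fv) (0, y) (1, 0), fun _ => 0,
    fun y => fderiv ℝ (Function.uncurry Gc) (0, y) (1, 0), fun _ => 0, hF₁, contDiff_const, hG₁,
    contDiff_const, fun y hy => ?_⟩
  -- differentiate the radial identities of the witness in `G` at `0`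
  have e1 : (fun G => w G (Real.log ‖y‖) • y) =ᶠ[𝓝 0] fun G => Fv G y := by
    filter_upwards [hIn] with G hG using (hreg G hG y hy).1
  have e2 : (fun G => ‖y‖ * s G (Real.log ‖y‖)) =ᶠ[𝓝 0] fun G => Gc G y := by
    filter_upwards [hIn] with G hG using (hreg G hG y hy).2
  have d1 := ((dw (Real.log ‖y‖)).smul_const y).unique ((dF y).congr_of_eventuallyEq e1)
  have d2 := ((ds (Real.log ‖y‖)).const_mul ‖y‖).unique ((dG y).congr_of_eventuallyEq e2)
  simp only [Complex.ofReal_re, Complex.ofReal_im, zero_smul, mul_zero]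
  exact ⟨d1, trivial, d2, trivial⟩

/-! ## Uniqueness at every order of the hierarchy (packing non-resonance) -/

/-- The difference of two centre-regular pairs is centre-regular. [folklore] -/
theorem isRegularPair_sub {u₁ u₂ v₁ v₂ : ℝ → ℂ} (hu : IsRegularPair u₁ u₂) (hv : IsRegularPair v₁ v₂) :
    IsRegularPair (fun x => u₁ x - v₁ x) (fun x => u₂ x - v₂ x) := by
  obtain ⟨hu1, hu2, F₁, F₂, G₁, G₂, hF₁, hF₂, hG₁, hG₂, hru⟩ := hu
  obtain ⟨hv1, hv2, F₁', F₂', G₁', G₂', hF₁', hF₂', hG₁', hG₂', hrv⟩ := hv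
  refine ⟨hu1.sub hv1, hu2.sub hv2, fun y => F₁ y - F₁' y, fun y => F₂ y - F₂' y, fun y => G₁ y - G₁' y,
    fun y => G₂ y - G₂' y, hF₁.sub hF₁', hF₂.sub hF₂', hG₁.sub hG₁', hG₂.sub hG₂', fun y hy => ?_⟩
  obtain ⟨e1, e2, e3, e4⟩ := hru y hy
  obtain ⟨e1', e2', e3', e4'⟩ := hrv y hy
  refine ⟨?_, ?_, ?_, ?_⟩
  · rw [Complex.sub_re, sub_smul, e1, e1']
  · rw [Complex.sub_im, sub_smul, e2, e2']
  · rw [Complex.sub_re, mul_sub, e3, e3']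
  · rw [Complex.sub_im, mul_sub, e4, e4']

/-- `L = (linW, linS)` is linear: its value on a difference of differentiable pairs. [folklore] -/
theorem lin_sub {r : ℝ} {W S : ℝ → ℝ} {u₁ u₂ v₁ v₂ : ℝ → ℂ} {x : ℝ} (hu1 : DifferentiableAt ℝ u₁ x)
    (hu2 : DifferentiableAt ℝ u₂ x) (hv1 : DifferentiableAt ℝ v₁ x) (hv2 : DifferentiableAt ℝ v₂ x) :
    linW r W S (fun y => u₁ y - v₁ y) (fun y => u₂ y - v₂ y) x = linW r W S u₁ u₂ x - linW r W S v₁ v₂ x ∧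
      linS r W S (fun y => u₁ y - v₁ y) (fun y => u₂ y - v₂ y) x =
        linS r W S u₁ u₂ x - linS r W S v₁ v₂ x := by
  simp only [linW, linS, deriv_fun_sub hu1 hv1, deriv_fun_sub hu2 hv2]
  constructor <;> ring

/-- **UNIQUENESS AT EVERY ORDER OF `Γ`'S HIERARCHY.** Under the `(1,2)` package and the gauge non-resonance
`k μ ≠ r`, the order-`k` problem `(kμ − L) X = Src` (`k ≥ 1`, `μ = 3(r−1)`) has AT MOST ONE smooth centre-regular
solution: the difference of two would be a smooth radial mode at `Λ = kμ`, excluded by `packing_nonresonance`.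
[folklore] -/
theorem hierarchy_solution_unique {r : ℝ} {W S : ℝ → ℝ} (hP : OneModeTwoConditions r W S)
    (hg : ∀ k : ℕ, (k : ℝ) * (3 * (r - 1)) ≠ r) {k : ℕ} (hk : 1 ≤ k) {f₁ f₂ u₁ u₂ v₁ v₂ : ℝ → ℂ}
    (hu : IsRegularPair u₁ u₂) (hv : IsRegularPair v₁ v₂)
    (hueq : ∀ x, (((k : ℝ) * (3 * (r - 1)) : ℝ) : ℂ) * u₁ x - linW r W S u₁ u₂ x = f₁ x ∧
      (((k : ℝ) * (3 * (r - 1)) : ℝ) : ℂ) * u₂ x - linS r W S u₁ u₂ x = f₂ x)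
    (hveq : ∀ x, (((k : ℝ) * (3 * (r - 1)) : ℝ) : ℂ) * v₁ x - linW r W S v₁ v₂ x = f₁ x ∧
      (((k : ℝ) * (3 * (r - 1)) : ℝ) : ℂ) * v₂ x - linS r W S v₁ v₂ x = f₂ x) :
    u₁ = v₁ ∧ u₂ = v₂ := by
  by_contra hne
  have hex : ∃ x, u₁ x - v₁ x ≠ 0 ∨ u₂ x - v₂ x ≠ 0 := by
    by_contra hall
    push Not at hall
    exact hne ⟨funext fun x => sub_eq_zero.1 (hall x).1, funext fun x => sub_eq_zero.1 (hall x).2⟩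
  refine packing_nonresonance hP hg k hk _ _ ⟨isRegularPair_sub hu hv, hex, fun x => ?_⟩
  have hu1 : Differentiable ℝ u₁ := hu.1.differentiable (by simp)
  have hu2 : Differentiable ℝ u₂ := hu.2.1.differentiable (by simp)
  have hv1 : Differentiable ℝ v₁ := hv.1.differentiable (by simp)
  have hv2 : Differentiable ℝ v₂ := hv.2.1.differentiable (by simp)
  obtain ⟨lW, lS⟩ := lin_sub (r := r) (W := W) (S := S) (hu1 x) (hu2 x) (hv1 x) (hv2 x)
  obtain ⟨a1, a2⟩ := hueq x
  obtain ⟨b1, b2⟩ := hveq x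
  rw [lW, lS]
  constructor
  · linear_combination a1 - b1
  · linear_combination a2 - b2

end Summit.AtomisticToContinuum.HydrodynamicLimit.Theorems.PackingAnalyticImplosion

end
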